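import Mathlib
import Summits.Ventures.FusionMHD.Models.CerfonFreidbergIterLikeQHalf
import HarnessLib

/-!
# Ventures/FusionMHD — Models/CerfonFreidbergIterLikeQHalfFacts.lean: the surface `ψ_N = 1/2` of THE Cerfon–Freidberg ITER-like flux AS A CERTIFIED
# CLOSED CURVE — continuity of the glued ray radius `ρ` and the pointwise surface facts on the whole period `[0, 2π]`

HONEST FRAMING (LADDER-GRIDFUSION three columns; CF rung, F2 item R2; companion of #117-cand «F2.CF-Q-INTERIOR-ITER», p552080).  From the 32
per-panel link theorems (`QHalfPanel.panel_bracket`, re-instantiated here for their qualitative part `PanelFacts k`): `ρ` is continuous on `[0, π]`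
(closed-union gluing), at every `θ ∈ [0, π]` the flux at `ρ(θ)` equals the level `u₀ = U(X_a,0)/2`, `0 < ρ(θ) < 1`, `D_r(θ, ρ θ) > 0` (floor covering);
the mirror symmetry `U(X, −Y) = U(X, Y)` + `2π`-periodicity transfer everything to `[0, 2π]` (`surface_facts`, `continuousOn_ρ`).  Consumer:
`Models/CerfonFreidbergIterLikeQHalfSurface.lean` (Freidberg's `(6.35)` loop integral = `F · qHalfOverF`).  MODELLED: analytic CF family; nothing about
a device or stability.  Typer/prover: gridfusion-model-5 (g7), 2026-08-27.  Citations: Freidberg 2014 §6.3.5 (6.35) [Freidberg2014].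
-/

noncomputable section

open Set MeasureTheory intervalIntegral
open Literature.Analysis.ValidatedNumerics Literature.Analysis.ValidatedNumerics.PolyMP Literature.Analysis.ValidatedNumerics.ExpPoly
open Literature.MathematicalPhysics.MHD Literature.MathematicalPhysics.MHD.CerfonFreidberg Literature.MathematicalPhysics.MHD.GradShafranov
open Summit.Ventures.FusionMHD.Models.PolarRay

namespace Summit.Ventures.FusionMHD.Models.CFIterLike.QHalf

/-! ## §1 The qualitative surface facts on `[0, π]`, then on `[0, 2π]` -/

/-- The per-panel qualitative facts: `ρ` continuous on `Θ_k` and, at every `θ ∈ Θ_k`, the level identity, the tube, `0 < ρ < 1`, `D_r > 0`. -/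
abbrev PanelFacts (k : ℕ) : Prop :=
  ContinuousOn ρ (Icc (aθ k) (aθ (k + 1))) ∧ ∀ θ ∈ Icc (aθ k) (aθ (k + 1)),
    rayProfile U Xa 0 θ (ρ θ) = u₀ ∧ |ρ θ - mθ θ| < (((lP k).r : ℚ) : ℝ) ∧ 0 < ρ θ ∧ ρ θ < 1 ∧ 0 < Dfield θ (ρ θ)

/-- Panel 0: continuity of `ρ` and the pointwise surface facts. -/
theorem pc0 : PanelFacts 0 := by
  have hj : (dP 0).j = 0 := by decide +kernel
  have h := panel_bracket (hdP 0 (by norm_num)) (hbP 0 (by norm_num)) (by decide +kernel : (lP 0).check (dP 0) (bP 0) = true)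
  rw [hj] at h; exact ⟨h.2.2.2.1, h.2.2.2.2⟩
/-- Panel 1: continuity of `ρ` and the pointwise surface facts. -/
theorem pc1 : PanelFacts 1 := by
  have hj : (dP 1).j = 1 := by decide +kernel
  have h := panel_bracket (hdP 1 (by norm_num)) (hbP 1 (by norm_num)) (by decide +kernel : (lP 1).check (dP 1) (bP 1) = true)
  rw [hj] at h; exact ⟨h.2.2.2.1, h.2.2.2.2⟩
/-- Panel 2: continuity of `ρ` and the pointwise surface facts. -/
theorem pc2 : PanelFacts 2 := by
  have hj : (dP 2).j = 2 := by decide +kernel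
  have h := panel_bracket (hdP 2 (by norm_num)) (hbP 2 (by norm_num)) (by decide +kernel : (lP 2).check (dP 2) (bP 2) = true)
  rw [hj] at h; exact ⟨h.2.2.2.1, h.2.2.2.2⟩
/-- Panel 3: continuity of `ρ` and the pointwise surface facts. -/
theorem pc3 : PanelFacts 3 := by
  have hj : (dP 3).j = 3 := by decide +kernel
  have h := panel_bracket (hdP 3 (by norm_num)) (hbP 3 (by norm_num)) (by decide +kernel : (lP 3).check (dP 3) (bP 3) = true)
  rw [hj] at h; exact ⟨h.2.2.2.1, h.2.2.2.2⟩
/-- Panel 4: continuity of `ρ` and the pointwise surface facts. -/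
theorem pc4 : PanelFacts 4 := by
  have hj : (dP 4).j = 4 := by decide +kernel
  have h := panel_bracket (hdP 4 (by norm_num)) (hbP 4 (by norm_num)) (by decide +kernel : (lP 4).check (dP 4) (bP 4) = true)
  rw [hj] at h; exact ⟨h.2.2.2.1, h.2.2.2.2⟩
/-- Panel 5: continuity of `ρ` and the pointwise surface facts. -/
theorem pc5 : PanelFacts 5 := by
  have hj : (dP 5).j = 5 := by decide +kernel
  have h := panel_bracket (hdP 5 (by norm_num)) (hbP 5 (by norm_num)) (by decide +kernel : (lP 5).check (dP 5) (bP 5) = true)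
  rw [hj] at h; exact ⟨h.2.2.2.1, h.2.2.2.2⟩
/-- Panel 6: continuity of `ρ` and the pointwise surface facts. -/
theorem pc6 : PanelFacts 6 := by
  have hj : (dP 6).j = 6 := by decide +kernel
  have h := panel_bracket (hdP 6 (by norm_num)) (hbP 6 (by norm_num)) (by decide +kernel : (lP 6).check (dP 6) (bP 6) = true)
  rw [hj] at h; exact ⟨h.2.2.2.1, h.2.2.2.2⟩
/-- Panel 7: continuity of `ρ` and the pointwise surface facts. -/
theorem pc7 : PanelFacts 7 := by
  have hj : (dP 7).j = 7 := by decide +kernel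
  have h := panel_bracket (hdP 7 (by norm_num)) (hbP 7 (by norm_num)) (by decide +kernel : (lP 7).check (dP 7) (bP 7) = true)
  rw [hj] at h; exact ⟨h.2.2.2.1, h.2.2.2.2⟩
/-- Panel 8: continuity of `ρ` and the pointwise surface facts. -/
theorem pc8 : PanelFacts 8 := by
  have hj : (dP 8).j = 8 := by decide +kernel
  have h := panel_bracket (hdP 8 (by norm_num)) (hbP 8 (by norm_num)) (by decide +kernel : (lP 8).check (dP 8) (bP 8) = true)
  rw [hj] at h; exact ⟨h.2.2.2.1, h.2.2.2.2⟩
/-- Panel 9: continuity of `ρ` and the pointwise surface facts. -/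
theorem pc9 : PanelFacts 9 := by
  have hj : (dP 9).j = 9 := by decide +kernel
  have h := panel_bracket (hdP 9 (by norm_num)) (hbP 9 (by norm_num)) (by decide +kernel : (lP 9).check (dP 9) (bP 9) = true)
  rw [hj] at h; exact ⟨h.2.2.2.1, h.2.2.2.2⟩
/-- Panel 10: continuity of `ρ` and the pointwise surface facts. -/
theorem pc10 : PanelFacts 10 := by
  have hj : (dP 10).j = 10 := by decide +kernel
  have h := panel_bracket (hdP 10 (by norm_num)) (hbP 10 (by norm_num)) (by decide +kernel : (lP 10).check (dP 10) (bP 10) = true)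
  rw [hj] at h; exact ⟨h.2.2.2.1, h.2.2.2.2⟩
/-- Panel 11: continuity of `ρ` and the pointwise surface facts. -/
theorem pc11 : PanelFacts 11 := by
  have hj : (dP 11).j = 11 := by decide +kernel
  have h := panel_bracket (hdP 11 (by norm_num)) (hbP 11 (by norm_num)) (by decide +kernel : (lP 11).check (dP 11) (bP 11) = true)
  rw [hj] at h; exact ⟨h.2.2.2.1, h.2.2.2.2⟩
/-- Panel 12: continuity of `ρ` and the pointwise surface facts. -/
theorem pc12 : PanelFacts 12 := by
  have hj : (dP 12).j = 12 := by decide +kernel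
  have h := panel_bracket (hdP 12 (by norm_num)) (hbP 12 (by norm_num)) (by decide +kernel : (lP 12).check (dP 12) (bP 12) = true)
  rw [hj] at h; exact ⟨h.2.2.2.1, h.2.2.2.2⟩
/-- Panel 13: continuity of `ρ` and the pointwise surface facts. -/
theorem pc13 : PanelFacts 13 := by
  have hj : (dP 13).j = 13 := by decide +kernel
  have h := panel_bracket (hdP 13 (by norm_num)) (hbP 13 (by norm_num)) (by decide +kernel : (lP 13).check (dP 13) (bP 13) = true)
  rw [hj] at h; exact ⟨h.2.2.2.1, h.2.2.2.2⟩
/-- Panel 14: continuity of `ρ` and the pointwise surface facts. -/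
theorem pc14 : PanelFacts 14 := by
  have hj : (dP 14).j = 14 := by decide +kernel
  have h := panel_bracket (hdP 14 (by norm_num)) (hbP 14 (by norm_num)) (by decide +kernel : (lP 14).check (dP 14) (bP 14) = true)
  rw [hj] at h; exact ⟨h.2.2.2.1, h.2.2.2.2⟩
/-- Panel 15: continuity of `ρ` and the pointwise surface facts. -/
theorem pc15 : PanelFacts 15 := by
  have hj : (dP 15).j = 15 := by decide +kernel
  have h := panel_bracket (hdP 15 (by norm_num)) (hbP 15 (by norm_num)) (by decide +kernel : (lP 15).check (dP 15) (bP 15) = true)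
  rw [hj] at h; exact ⟨h.2.2.2.1, h.2.2.2.2⟩
/-- Panel 16: continuity of `ρ` and the pointwise surface facts. -/
theorem pc16 : PanelFacts 16 := by
  have hj : (dP 16).j = 16 := by decide +kernel
  have h := panel_bracket (hdP 16 (by norm_num)) (hbP 16 (by norm_num)) (by decide +kernel : (lP 16).check (dP 16) (bP 16) = true)
  rw [hj] at h; exact ⟨h.2.2.2.1, h.2.2.2.2⟩
/-- Panel 17: continuity of `ρ` and the pointwise surface facts. -/
theorem pc17 : PanelFacts 17 := by
  have hj : (dP 17).j = 17 := by decide +kernel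
  have h := panel_bracket (hdP 17 (by norm_num)) (hbP 17 (by norm_num)) (by decide +kernel : (lP 17).check (dP 17) (bP 17) = true)
  rw [hj] at h; exact ⟨h.2.2.2.1, h.2.2.2.2⟩
/-- Panel 18: continuity of `ρ` and the pointwise surface facts. -/
theorem pc18 : PanelFacts 18 := by
  have hj : (dP 18).j = 18 := by decide +kernel
  have h := panel_bracket (hdP 18 (by norm_num)) (hbP 18 (by norm_num)) (by decide +kernel : (lP 18).check (dP 18) (bP 18) = true)
  rw [hj] at h; exact ⟨h.2.2.2.1, h.2.2.2.2⟩
/-- Panel 19: continuity of `ρ` and the pointwise surface facts. -/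
theorem pc19 : PanelFacts 19 := by
  have hj : (dP 19).j = 19 := by decide +kernel
  have h := panel_bracket (hdP 19 (by norm_num)) (hbP 19 (by norm_num)) (by decide +kernel : (lP 19).check (dP 19) (bP 19) = true)
  rw [hj] at h; exact ⟨h.2.2.2.1, h.2.2.2.2⟩
/-- Panel 20: continuity of `ρ` and the pointwise surface facts. -/
theorem pc20 : PanelFacts 20 := by
  have hj : (dP 20).j = 20 := by decide +kernel
  have h := panel_bracket (hdP 20 (by norm_num)) (hbP 20 (by norm_num)) (by decide +kernel : (lP 20).check (dP 20) (bP 20) = true)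
  rw [hj] at h; exact ⟨h.2.2.2.1, h.2.2.2.2⟩
/-- Panel 21: continuity of `ρ` and the pointwise surface facts. -/
theorem pc21 : PanelFacts 21 := by
  have hj : (dP 21).j = 21 := by decide +kernel
  have h := panel_bracket (hdP 21 (by norm_num)) (hbP 21 (by norm_num)) (by decide +kernel : (lP 21).check (dP 21) (bP 21) = true)
  rw [hj] at h; exact ⟨h.2.2.2.1, h.2.2.2.2⟩
/-- Panel 22: continuity of `ρ` and the pointwise surface facts. -/
theorem pc22 : PanelFacts 22 := by
  have hj : (dP 22).j = 22 := by decide +kernel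
  have h := panel_bracket (hdP 22 (by norm_num)) (hbP 22 (by norm_num)) (by decide +kernel : (lP 22).check (dP 22) (bP 22) = true)
  rw [hj] at h; exact ⟨h.2.2.2.1, h.2.2.2.2⟩
/-- Panel 23: continuity of `ρ` and the pointwise surface facts. -/
theorem pc23 : PanelFacts 23 := by
  have hj : (dP 23).j = 23 := by decide +kernel
  have h := panel_bracket (hdP 23 (by norm_num)) (hbP 23 (by norm_num)) (by decide +kernel : (lP 23).check (dP 23) (bP 23) = true)
  rw [hj] at h; exact ⟨h.2.2.2.1, h.2.2.2.2⟩
/-- Panel 24: continuity of `ρ` and the pointwise surface facts. -/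
theorem pc24 : PanelFacts 24 := by
  have hj : (dP 24).j = 24 := by decide +kernel
  have h := panel_bracket (hdP 24 (by norm_num)) (hbP 24 (by norm_num)) (by decide +kernel : (lP 24).check (dP 24) (bP 24) = true)
  rw [hj] at h; exact ⟨h.2.2.2.1, h.2.2.2.2⟩
/-- Panel 25: continuity of `ρ` and the pointwise surface facts. -/
theorem pc25 : PanelFacts 25 := by
  have hj : (dP 25).j = 25 := by decide +kernel
  have h := panel_bracket (hdP 25 (by norm_num)) (hbP 25 (by norm_num)) (by decide +kernel : (lP 25).check (dP 25) (bP 25) = true)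
  rw [hj] at h; exact ⟨h.2.2.2.1, h.2.2.2.2⟩
/-- Panel 26: continuity of `ρ` and the pointwise surface facts. -/
theorem pc26 : PanelFacts 26 := by
  have hj : (dP 26).j = 26 := by decide +kernel
  have h := panel_bracket (hdP 26 (by norm_num)) (hbP 26 (by norm_num)) (by decide +kernel : (lP 26).check (dP 26) (bP 26) = true)
  rw [hj] at h; exact ⟨h.2.2.2.1, h.2.2.2.2⟩
/-- Panel 27: continuity of `ρ` and the pointwise surface facts. -/
theorem pc27 : PanelFacts 27 := by
  have hj : (dP 27).j = 27 := by decide +kernel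
  have h := panel_bracket (hdP 27 (by norm_num)) (hbP 27 (by norm_num)) (by decide +kernel : (lP 27).check (dP 27) (bP 27) = true)
  rw [hj] at h; exact ⟨h.2.2.2.1, h.2.2.2.2⟩
/-- Panel 28: continuity of `ρ` and the pointwise surface facts. -/
theorem pc28 : PanelFacts 28 := by
  have hj : (dP 28).j = 28 := by decide +kernel
  have h := panel_bracket (hdP 28 (by norm_num)) (hbP 28 (by norm_num)) (by decide +kernel : (lP 28).check (dP 28) (bP 28) = true)
  rw [hj] at h; exact ⟨h.2.2.2.1, h.2.2.2.2⟩
/-- Panel 29: continuity of `ρ` and the pointwise surface facts. -/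
theorem pc29 : PanelFacts 29 := by
  have hj : (dP 29).j = 29 := by decide +kernel
  have h := panel_bracket (hdP 29 (by norm_num)) (hbP 29 (by norm_num)) (by decide +kernel : (lP 29).check (dP 29) (bP 29) = true)
  rw [hj] at h; exact ⟨h.2.2.2.1, h.2.2.2.2⟩
/-- Panel 30: continuity of `ρ` and the pointwise surface facts. -/
theorem pc30 : PanelFacts 30 := by
  have hj : (dP 30).j = 30 := by decide +kernel
  have h := panel_bracket (hdP 30 (by norm_num)) (hbP 30 (by norm_num)) (by decide +kernel : (lP 30).check (dP 30) (bP 30) = true)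
  rw [hj] at h; exact ⟨h.2.2.2.1, h.2.2.2.2⟩
/-- Panel 31: continuity of `ρ` and the pointwise surface facts. -/
theorem pc31 : PanelFacts 31 := by
  have hj : (dP 31).j = 31 := by decide +kernel
  have h := panel_bracket (hdP 31 (by norm_num)) (hbP 31 (by norm_num)) (by decide +kernel : (lP 31).check (dP 31) (bP 31) = true)
  rw [hj] at h; exact ⟨h.2.2.2.1, h.2.2.2.2⟩

/-- Covering of `[0, π]` by the 32 panels. -/
theorem exists_panelθ {θ : ℝ} (h0 : 0 ≤ θ) (h1 : θ ≤ Real.pi) : ∃ k, k < 32 ∧ θ ∈ Icc (aθ k) (aθ (k + 1)) := by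
  have hpi := Real.pi_pos
  have hak : ∀ k : ℕ, aθ k = Real.pi * (k / 32) := by
    intro k; simp only [aθ, panelLeft, hw]; push_cast; ring
  set w : ℝ := Real.pi / 32 with hw'
  have hwpos : 0 < w := by positivity
  set k := ⌊θ / w⌋₊ with hk
  have h3 : (k : ℝ) * w ≤ θ := by rw [← le_div_iff₀ hwpos]; exact Nat.floor_le (div_nonneg h0 hwpos.le)
  have h4 : θ < ((k : ℝ) + 1) * w := by rw [← div_lt_iff₀ hwpos]; exact Nat.lt_floor_add_one _
  by_cases hkn : k < 32
  · refine ⟨k, hkn, ?_, ?_⟩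
    · rw [hak]; have : Real.pi * ((k : ℕ) / 32 : ℝ) = (k : ℝ) * w := by rw [hw']; ring
      rw [this]; exact h3
    · rw [hak]; push_cast
      have : Real.pi * (((k : ℝ) + 1) / 32) = ((k : ℝ) + 1) * w := by rw [hw']; ring
      rw [this]; exact h4.le
  · refine ⟨31, by norm_num, ?_, ?_⟩
    · rw [hak]
      have hk32 : (32 : ℝ) ≤ (k : ℝ) := by exact_mod_cast not_lt.1 hkn
      have : (32 : ℝ) * w ≤ θ := le_trans (mul_le_mul_of_nonneg_right hk32 hwpos.le) h3
      have e : Real.pi * ((31 : ℕ) / 32 : ℝ) = 31 * w := by rw [hw']; push_cast; ring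
      rw [e]; linarith
    · rw [hak]
      have e : Real.pi * (((31 + 1 : ℕ) : ℝ) / 32) = Real.pi := by push_cast; ring
      rw [e]; exact h1

/-- **`ρ` is continuous on `[0, π]`** (closed-union gluing of the 32 panels). -/
theorem continuousOn_ρ_half : ContinuousOn ρ (Icc 0 Real.pi) := by
  have hcont : ∀ k < 32, ContinuousOn ρ (Icc (aθ k) (aθ (k + 1))) := by
    intro k hk
    interval_cases k
    · exact pc0.1
    · exact pc1.1
    · exact pc2.1
    · exact pc3.1
    · exact pc4.1
    · exact pc5.1
    · exact pc6.1
    · exact pc7.1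
    · exact pc8.1
    · exact pc9.1
    · exact pc10.1
    · exact pc11.1
    · exact pc12.1
    · exact pc13.1
    · exact pc14.1
    · exact pc15.1
    · exact pc16.1
    · exact pc17.1
    · exact pc18.1
    · exact pc19.1
    · exact pc20.1
    · exact pc21.1
    · exact pc22.1
    · exact pc23.1
    · exact pc24.1
    · exact pc25.1
    · exact pc26.1
    · exact pc27.1
    · exact pc28.1
    · exact pc29.1
    · exact pc30.1
    · exact pc31.1
  -- glue: by induction on the number of panels
  have hmono : ∀ k : ℕ, aθ k ≤ aθ (k + 1) := by
    intro k; simp only [aθ, panelLeft, hw]; push_cast; nlinarith [Real.pi_pos]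
  have hglue : ∀ n : ℕ, n ≤ 32 → ContinuousOn ρ (Icc (aθ 0) (aθ n)) := by
    intro n
    induction n with
    | zero => intro _; exact (hcont 0 (by norm_num)).mono (Icc_subset_Icc le_rfl (hmono 0))
    | succ n ih =>
      intro hn
      have h1 := ih (by omega)
      have h2 := hcont n (by omega)
      have hun : Icc (aθ 0) (aθ (n + 1)) = Icc (aθ 0) (aθ n) ∪ Icc (aθ n) (aθ (n + 1)) := by
        rw [Icc_union_Icc_eq_Icc]
        · clear h1 h2 ih hn; induction n with
          | zero => exact le_rfl
          | succ m ihm => exact ihm.trans (hmono m)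
        · exact hmono n
      rw [hun]
      exact h1.union_of_isClosed h2 isClosed_Icc isClosed_Icc
  have h := hglue 32 le_rfl
  rwa [aθ_ends.1, aθ_ends.2] at h

/-- **The pointwise surface facts on `[0, π]`.** -/
theorem surface_facts_half {θ : ℝ} (h0 : 0 ≤ θ) (h1 : θ ≤ Real.pi) :
    rayProfile U Xa 0 θ (ρ θ) = u₀ ∧ 0 < ρ θ ∧ ρ θ < 1 ∧ 0 < Dfield θ (ρ θ) := by
  obtain ⟨k, hk, hθk⟩ := exists_panelθ h0 h1
  have h : rayProfile U Xa 0 θ (ρ θ) = u₀ ∧ |ρ θ - mθ θ| < (((lP k).r : ℚ) : ℝ) ∧ 0 < ρ θ ∧ ρ θ < 1 ∧ 0 < Dfield θ (ρ θ) := by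
    interval_cases k
    · exact (pc0.2 θ hθk)
    · exact (pc1.2 θ hθk)
    · exact (pc2.2 θ hθk)
    · exact (pc3.2 θ hθk)
    · exact (pc4.2 θ hθk)
    · exact (pc5.2 θ hθk)
    · exact (pc6.2 θ hθk)
    · exact (pc7.2 θ hθk)
    · exact (pc8.2 θ hθk)
    · exact (pc9.2 θ hθk)
    · exact (pc10.2 θ hθk)
    · exact (pc11.2 θ hθk)
    · exact (pc12.2 θ hθk)
    · exact (pc13.2 θ hθk)
    · exact (pc14.2 θ hθk)
    · exact (pc15.2 θ hθk)
    · exact (pc16.2 θ hθk)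
    · exact (pc17.2 θ hθk)
    · exact (pc18.2 θ hθk)
    · exact (pc19.2 θ hθk)
    · exact (pc20.2 θ hθk)
    · exact (pc21.2 θ hθk)
    · exact (pc22.2 θ hθk)
    · exact (pc23.2 θ hθk)
    · exact (pc24.2 θ hθk)
    · exact (pc25.2 θ hθk)
    · exact (pc26.2 θ hθk)
    · exact (pc27.2 θ hθk)
    · exact (pc28.2 θ hθk)
    · exact (pc29.2 θ hθk)
    · exact (pc30.2 θ hθk)
    · exact (pc31.2 θ hθk)
  exact ⟨h.1, h.2.2.1, h.2.2.2.1, h.2.2.2.2⟩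

/-- `2π`-periodicity and mirror: `ρ (2π − x) = ρ x`, `Dfield (2π − x) s = Dfield x s`, `rayProfile (2π − x) = rayProfile x`. -/
theorem mirror (x : ℝ) : ρ (2 * Real.pi - x) = ρ x ∧ (∀ s, Dfield (2 * Real.pi - x) s = Dfield x s)
    ∧ (∀ s, rayProfile U Xa 0 (2 * Real.pi - x) s = rayProfile U Xa 0 x s) := by
  have e : 2 * Real.pi - x = -x + 2 * Real.pi := by ring
  refine ⟨?_, ?_, ?_⟩
  · rw [e, show ρ (-x + 2 * Real.pi) = ρ (-x) from periodic_rayRadius U Xa 0 u₀ (-x), ρ_neg]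
  · intro s; rw [e, Dfield_periodic, Dfield_neg]
  · intro s; rw [e, show rayProfile U Xa 0 (-x + 2 * Real.pi) s = rayProfile U Xa 0 (-x) s from periodic_rayProfile U Xa 0 s (-x),
      rayProfile_neg]

/-- **The surface facts on the whole period `[0, 2π]`.** -/
theorem surface_facts {θ : ℝ} (hθ : θ ∈ Icc 0 (2 * Real.pi)) :
    rayProfile U Xa 0 θ (ρ θ) = u₀ ∧ 0 < ρ θ ∧ ρ θ < 1 ∧ 0 < Dfield θ (ρ θ) := by
  by_cases h : θ ≤ Real.pi
  · exact surface_facts_half hθ.1 h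
  · push Not at h
    have hx0 : 0 ≤ 2 * Real.pi - θ := by linarith [hθ.2]
    have hx1 : 2 * Real.pi - θ ≤ Real.pi := by linarith
    obtain ⟨hρ, hD, hP⟩ := mirror (2 * Real.pi - θ)
    simp only [sub_sub_cancel] at hρ hD hP
    obtain ⟨a, b, c, d⟩ := surface_facts_half hx0 hx1
    rw [← hρ] at a b c d; rw [← hD] at d; rw [← hP] at a
    exact ⟨a, b, c, d⟩

/-- **`ρ` is continuous on `[0, 2π]`.** -/
theorem continuousOn_ρ : ContinuousOn ρ (Icc 0 (2 * Real.pi)) := by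
  have hpi := Real.pi_pos
  have h2 : ContinuousOn ρ (Icc Real.pi (2 * Real.pi)) := by
    have hc : ContinuousOn (fun x => ρ (2 * Real.pi - x)) (Icc Real.pi (2 * Real.pi)) := by
      refine continuousOn_ρ_half.comp (by fun_prop) ?_
      intro x hx; exact ⟨by linarith [hx.2], by linarith [hx.1]⟩
    exact hc.congr fun x _ => ((mirror x).1).symm
  have hun : Icc 0 (2 * Real.pi) = Icc 0 Real.pi ∪ Icc Real.pi (2 * Real.pi) := by
    rw [Icc_union_Icc_eq_Icc] <;> linarith
  rw [hun]
  exact continuousOn_ρ_half.union_of_isClosed h2 isClosed_Icc isClosed_Icc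

end Summit.Ventures.FusionMHD.Models.CFIterLike.QHalf

end
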